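import Mathlib.FieldTheory.Finiteness
import Mathlib.LinearAlgebra.FiniteDimensional.Lemmas
import Mathlib.Analysis.SpecialFunctions.Log.Base
import Mathlib.Algebra.Field.ZMod
import Literature.InformationTheory.Entropy.MapEntropy
import HarnessLib

/-!
# Entropy of the image of a uniform distribution under a linear or affine map over a finite field

For a linear map `f : V → W` of finite-dimensional vector spaces over a finite field `F` (with `V`
finite), the image `f(U_V)` of the uniform distribution on `V` is uniform on the subspace `range f`,
so its Shannon entropy in bits is

  `H(f(U_V)) = dim (range f) · log₂ |F|`   (`mapEntropy_univ_linearMap`),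

in particular `H(f(U_V)) = rank f` over `F₂` (`mapEntropy_univ_linearMap_zmod_two`), and the same
holds for affine maps `v ↦ f v + w₀` (`mapEntropy_univ_affine`, `mapEntropy_univ_affine_zmod_two`).
This is the "degree `1` = matrix rank" base case of entropy approximation for polynomial maps
[Dvir–Gutfreund–Rothblum–Vadhan 2010, §1 p. 1]: every fibre of `f` is a coset of `ker f`
(`card_fiber_linearMap`), `|ker f| = |F| ^ dim (ker f)` (`card_filter_apply_eq_zero`), and rank–nullity
(`LinearMap.finrank_range_add_finrank_ker`).

## Contents

* `card_fiber_linearMap`, `card_filter_apply_eq_zero` — fibres of a linear map are kernel cosets;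
* `mapEntropy_univ_linearMap`, `mapEntropy_univ_affine` — over any finite field;
* `mapEntropy_univ_linearMap_zmod_two`, `mapEntropy_univ_affine_zmod_two` — over `F₂` (bits = rank).

Not here: entropy of polynomial maps of higher degree; Rényi entropies (for a linear map all Rényi
entropies coincide with the Shannon entropy, since the image distribution is flat).

## References

* Z. Dvir, D. Gutfreund, G. N. Rothblum, S. Vadhan, *On approximating the entropy of polynomial
  mappings*, ICS 2011 (ECCC TR10-160), §1 p. 1 (the degree-1 case is linear algebra), Claim 2.2
  (flat distributions).  bib `DvirGutfreundRothblumVadhan2010`.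
* T. Cover, J. Thomas, *Elements of Information Theory*, 2nd ed., Thm 2.6.4 (uniform maximises).
-/

namespace Literature.InformationTheory.Entropy

open Finset Module

variable {F : Type*} [Field F] [Fintype F]
variable {V W : Type*} [AddCommGroup V] [Module F V] [Fintype V] [AddCommGroup W] [Module F W]
  [DecidableEq W]

omit [Fintype F] in
/-- **Fibres of a linear map are cosets of the kernel**: the fibre of `f` through any `v` has as
many points as the zero set of `f` (translate by `-v`). [folklore] -/
theorem card_fiber_linearMap (f : V →ₗ[F] W) (v : V) :
    (fiber univ f (f v)).card = (univ.filter fun w : V => f w = 0).card := by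
  refine Finset.card_bij (fun v' _ => v' - v) (fun v' hv' => ?_) (fun a _ b _ h => sub_left_injective h)
    (fun w hw => ⟨w + v, ?_, add_sub_cancel_right w v⟩)
  · simp only [mem_fiber, mem_univ, true_and] at hv'
    simp only [mem_filter, mem_univ, true_and, map_sub, hv', sub_self]
  · simp only [mem_filter, mem_univ, true_and] at hw
    simp only [mem_fiber, mem_univ, true_and, map_add, hw, zero_add]

/-- **The zero set of a linear map has `|F| ^ dim (ker f)` points** (it is the subspace `ker f`).
[folklore] -/
theorem card_filter_apply_eq_zero (f : V →ₗ[F] W) :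
    (univ.filter fun w : V => f w = 0).card = Fintype.card F ^ finrank F (LinearMap.ker f) := by
  classical
  rw [← Module.card_eq_pow_finrank (K := F) (V := LinearMap.ker f)]
  exact (Fintype.card_of_subtype _ fun w => by simp [LinearMap.mem_ker]).symm

/-- **Entropy of a linear image of the uniform distribution**: for a linear map `f : V → W` over a
finite field `F`, `H(f(U_V)) = dim (range f) · log₂ |F|` — the image distribution is flat on the
`|F| ^ rank f` points of `range f`. [DvirGutfreundRothblumVadhan2010, §1 p. 1 and Claim 2.2]
[cite: DvirGutfreundRothblumVadhan2010, §1 p.1] -/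
theorem mapEntropy_univ_linearMap (f : V →ₗ[F] W) :
    mapEntropy univ ⇑f = finrank F (LinearMap.range f) * Real.logb 2 (Fintype.card F) := by
  classical
  set q : ℕ := Fintype.card F with hq_def
  have hq1 : (1 : ℝ) < q := by exact_mod_cast (Fintype.one_lt_card : 1 < Fintype.card F)
  have hq0 : (q : ℝ) ≠ 0 := by positivity
  have hV : Fintype.card V = q ^ finrank F V := Module.card_eq_pow_finrank
  have hrk : finrank F (LinearMap.range f) + finrank F (LinearMap.ker f) = finrank F V :=
    LinearMap.finrank_range_add_finrank_ker f
  set r := finrank F (LinearMap.range f)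
  set k := finrank F (LinearMap.ker f)
  have hterm : ∀ v : V, Real.logb 2 (((univ : Finset V).card : ℝ) / (fiber univ f (f v)).card) =
      r * Real.logb 2 q := by
    intro v
    rw [card_fiber_linearMap, card_filter_apply_eq_zero, Finset.card_univ, hV, ← hrk]
    push_cast
    rw [pow_add, mul_div_cancel_right₀ _ (pow_ne_zero _ hq0), Real.logb_pow]
  unfold mapEntropy
  rw [Finset.sum_congr rfl fun v _ => hterm v, Finset.sum_const, nsmul_eq_mul]
  have hcard0 : ((univ : Finset V).card : ℝ) ≠ 0 := by
    exact_mod_cast (Finset.card_pos.2 ⟨0, mem_univ _⟩).ne'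
  field_simp

/-- **Entropy of an affine image of the uniform distribution**: translating the outputs by `w₀`
does not change the entropy, so `H((f + w₀)(U_V)) = dim (range f) · log₂ |F|`.
[DvirGutfreundRothblumVadhan2010, §1 p. 1] [cite: DvirGutfreundRothblumVadhan2010, §1 p.1] -/
theorem mapEntropy_univ_affine (f : V →ₗ[F] W) (w₀ : W) :
    mapEntropy univ (fun v => f v + w₀) = finrank F (LinearMap.range f) * Real.logb 2 (Fintype.card F) := by
  rw [← mapEntropy_univ_linearMap f]
  exact mapEntropy_comp_of_injOn (⇑f) (fun y => y + w₀) fun a _ b _ h => add_right_cancel h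

/-! ### Over `F₂`: entropy in bits is the rank -/

section ZModTwo

variable {V₂ W₂ : Type*} [AddCommGroup V₂] [Module (ZMod 2) V₂] [Fintype V₂] [AddCommGroup W₂]
  [Module (ZMod 2) W₂] [DecidableEq W₂]

/-- **Over `F₂` the entropy of a linear image of the uniform distribution is the rank** (in bits):
`H(f(U_V)) = dim (range f)`. [DvirGutfreundRothblumVadhan2010, §1 p. 1 ("for degree 1 … the
entropy is determined by the rank")] [cite: DvirGutfreundRothblumVadhan2010, §1 p.1] -/
theorem mapEntropy_univ_linearMap_zmod_two (f : V₂ →ₗ[ZMod 2] W₂) :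
    mapEntropy univ ⇑f = finrank (ZMod 2) (LinearMap.range f) := by
  rw [mapEntropy_univ_linearMap (F := ZMod 2) f, ZMod.card, Nat.cast_ofNat,
    Real.logb_self_eq_one one_lt_two, mul_one]

/-- **Over `F₂` the entropy of an affine image of the uniform distribution is the rank of its
linear part.** [DvirGutfreundRothblumVadhan2010, §1 p. 1] [cite: DvirGutfreundRothblumVadhan2010, §1 p.1] -/
theorem mapEntropy_univ_affine_zmod_two (f : V₂ →ₗ[ZMod 2] W₂) (w₀ : W₂) :
    mapEntropy univ (fun v => f v + w₀) = finrank (ZMod 2) (LinearMap.range f) := by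
  rw [mapEntropy_univ_affine (F := ZMod 2) f w₀, ZMod.card, Nat.cast_ofNat,
    Real.logb_self_eq_one one_lt_two, mul_one]

end ZModTwo

end Literature.InformationTheory.Entropy
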